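import Mathlib.Analysis.SpecialFunctions.Trigonometric.Bounds
import Mathlib.Geometry.Euclidean.Angle.Unoriented.TriangleInequality
import Literature.Geometry.DiscreteGeometry.SphericalExcessEuler
import HarnessLib

/-!
# The polar length bound: a great-circle arc whose great circle stays at spherical distance
# `≥ arcsin s` from a point `z` is at least `s` times the angle it subtends at `z` — brick (S7)
# of (d3) «one rattler per p-hexagon»

HONEST FRAMING. Part of the venture `Summits/Ventures/Crystal3D` (cell `pub-crystal3d`, phase 2;
seat typer-bulk-2), generic and configuration-free: `V` is any real inner product space; nothing
here mentions GAP(1.26). In the perimeter proof of the census row (d3) of `DESIGN-L12-THEORY.md`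
§P-L3 (`phase2/theory1/HEX-PERIMETER.md`, plan `HOME/lean/hexper/README.md`), the boundary of the
(cut) face is split into pieces, each a great-circle arc `m m'` lying on a great circle at
spherical distance `≥ r₀` from a cap centre `z` (`⟪z, u⟫ ≥ s = sin r₀` for a unit normal `u` of
the arc's plane); the classical "polar coordinates" estimate `ds ≥ sin r₀ · dθ` then bounds the
length of the piece below by `sin r₀` times the angle it SUBTENDS at `z` (the angle between the
tangential projections `perpTo z m`, `perpTo z m'`). This file proves a calculus-free version
with an explicit loss factor `1001/1000` (costing `0.15°` of the `3.96°` margin):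

* `sq_inner_le_of_orthogonal`, `norm_perpTo_ge` — a unit `m ⊥ u` has `⟪z,m⟫² ≤ 1 − ⟪z,u⟫²`,
  so `‖perpTo z m‖ ≥ ⟪z,u⟫`;
* **chord bound** `sq_inner_mul_one_sub_cos_le` — `⟪z,u⟫² (1 − cos ψ) ≤ 1 − cos ℓ` for the
  subtended angle `ψ` and the arc length `ℓ = angle m m'` (the projection `perpTo z` is a
  contraction, and normalising two vectors of norm `≥ σ` stretches their distance by `≤ 1/σ`);
* **small arcs** `angle_le_of_one_sub_cos` — if moreover `ℓ ≤ 1/16` and `3/4 ≤ s ≤ ⟪z,u⟫` then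
  `ψ ≤ (1001/1000) ℓ / ⟪z,u⟫` (`1 − x²/2 ≤ cos x` and `Real.cos_bound`);
* **bisection** `angle_midpoint_left/right` (the normalised midpoint of an arc `< π` halves it)
  and `angle_perpTo_le_bisect` — induction over `2^k` equal sub-arcs;
* **polar bound** `mul_angle_perpTo_le` — for unit `z, u` with `3/4 ≤ s ≤ ⟪z,u⟫`, `s ≤ 1`, and
  unit `m, m' ⊥ u`: `s · angle (perpTo z m) (perpTo z m') ≤ (1001/1000) · angle m m'`.
-/

noncomputable section

namespace Summit.Ventures.Crystal3D

open Literature.Geometry.DiscreteGeometry Real InnerProductGeometry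
open scoped InnerProductSpace RealInnerProductSpace

variable {V : Type*} [NormedAddCommGroup V] [InnerProductSpace ℝ V]

/-! ## Part A. Projections of points of a great circle -/

/-- For unit `z, u` and a unit `m ⊥ u`: `⟪z, m⟫² ≤ 1 − ⟪z, u⟫²` (the component of `z` in the
plane `u⊥` has norm `√(1 − ⟪z,u⟫²)`). -/
theorem sq_inner_le_of_orthogonal {z u m : V} (hz : ‖z‖ = 1) (hu : ‖u‖ = 1) (hm : ‖m‖ = 1)
    (hmu : ⟪m, u⟫ = 0) : ⟪z, m⟫ ^ 2 ≤ 1 - ⟪z, u⟫ ^ 2 := by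
  have hzz : ⟪z, z⟫ = 1 := by rw [real_inner_self_eq_norm_sq, hz, one_pow]
  have huu : ⟪u, u⟫ = 1 := by rw [real_inner_self_eq_norm_sq, hu, one_pow]
  have hum : ⟪u, m⟫ = 0 := by rw [real_inner_comm]; exact hmu
  -- `z' = z − ⟪z,u⟫ u` has `⟪z', m⟫ = ⟪z, m⟫` and `‖z'‖² = 1 − ⟪z,u⟫²`
  have h1 : ⟪z - ⟪z, u⟫ • u, m⟫ = ⟪z, m⟫ := by
    rw [inner_sub_left, real_inner_smul_left, hum, mul_zero, sub_zero]
  have h2 : ‖z - ⟪z, u⟫ • u‖ ^ 2 = 1 - ⟪z, u⟫ ^ 2 := by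
    rw [← real_inner_self_eq_norm_sq, inner_sub_left, inner_sub_right, inner_sub_right,
      real_inner_smul_left, real_inner_smul_right, real_inner_smul_left, real_inner_smul_right,
      hzz, huu, real_inner_comm z u]
    ring
  have h3 : ⟪z - ⟪z, u⟫ • u, m⟫ ^ 2 ≤ ‖z - ⟪z, u⟫ • u‖ ^ 2 * ‖m‖ ^ 2 := by
    have := abs_real_inner_le_norm (z - ⟪z, u⟫ • u) m
    rw [← sq_abs]
    have h0 : 0 ≤ ‖z - ⟪z, u⟫ • u‖ * ‖m‖ := mul_nonneg (norm_nonneg _) (norm_nonneg _)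
    nlinarith [abs_nonneg ⟪z - ⟪z, u⟫ • u, m⟫]
  rw [h1, h2, hm, one_pow, mul_one] at h3
  exact h3

/-- For a unit `z`: `‖perpTo z x‖² = ‖x‖² − ⟪z, x⟫²` (Pythagoras). -/
theorem norm_perpTo_sq_of_unit {z : V} (hz : ‖z‖ = 1) (x : V) :
    ‖perpTo z x‖ ^ 2 = ‖x‖ ^ 2 - ⟪z, x⟫ ^ 2 := by
  have hzz : ⟪z, z⟫ = 1 := by rw [real_inner_self_eq_norm_sq, hz, one_pow]
  rw [perpTo_of_norm_eq_one hz, ← real_inner_self_eq_norm_sq, ← real_inner_self_eq_norm_sq,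
    inner_sub_left, inner_sub_right, inner_sub_right, real_inner_smul_left, real_inner_smul_right,
    real_inner_smul_left, real_inner_smul_right, hzz, real_inner_comm z x]
  ring

/-- The projection `perpTo z` (unit `z`) is a contraction. -/
theorem norm_perpTo_le_of_unit {z : V} (hz : ‖z‖ = 1) (x : V) : ‖perpTo z x‖ ≤ ‖x‖ := by
  have h := norm_perpTo_sq_of_unit hz x
  have h1 : ‖perpTo z x‖ ^ 2 ≤ ‖x‖ ^ 2 := by rw [h]; nlinarith [sq_nonneg ⟪z, x⟫]
  exact (pow_le_pow_iff_left₀ (norm_nonneg _) (norm_nonneg _) two_ne_zero).1 h1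

/-- `perpTo z` is additive/subtractive in its second argument (unit `z`). -/
theorem perpTo_sub_right_of_unit {z : V} (hz : ‖z‖ = 1) (x y : V) :
    perpTo z (x - y) = perpTo z x - perpTo z y := by
  rw [perpTo_of_norm_eq_one hz, perpTo_of_norm_eq_one hz, perpTo_of_norm_eq_one hz, inner_sub_right,
    sub_smul]
  abel

/-- For unit `z, u` with `0 < ⟪z,u⟫` and a unit `m ⊥ u`: `⟪z,u⟫ ≤ ‖perpTo z m‖`. -/
theorem inner_le_norm_perpTo {z u m : V} (hz : ‖z‖ = 1) (hu : ‖u‖ = 1) (hσ : 0 < ⟪z, u⟫)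
    (hm : ‖m‖ = 1) (hmu : ⟪m, u⟫ = 0) : ⟪z, u⟫ ≤ ‖perpTo z m‖ := by
  have h1 : ⟪z, u⟫ ^ 2 ≤ ‖perpTo z m‖ ^ 2 := by
    rw [norm_perpTo_sq_of_unit hz, hm, one_pow]
    have := sq_inner_le_of_orthogonal hz hu hm hmu
    linarith
  nlinarith [norm_nonneg (perpTo z m), sq_nonneg (‖perpTo z m‖ - ⟪z, u⟫)]

/-! ## Part B. The chord bound -/

/-- Normalising two nonzero vectors stretches their distance by at most `1/√(‖a‖‖b‖)`:
`‖a‖ ‖b‖ (1 − cos ∠(a,b)) ≤ ‖a − b‖² / 2`. -/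
theorem norm_mul_norm_mul_one_sub_cos_angle_le {a b : V} (ha : a ≠ 0) (hb : b ≠ 0) :
    ‖a‖ * ‖b‖ * (1 - Real.cos (angle a b)) ≤ ‖a - b‖ ^ 2 / 2 := by
  rw [cos_angle, norm_sub_sq_real]
  have hab : 0 < ‖a‖ * ‖b‖ := mul_pos (norm_pos_iff.2 ha) (norm_pos_iff.2 hb)
  rw [mul_sub, mul_one, mul_div_cancel₀ _ hab.ne']
  nlinarith [sq_nonneg (‖a‖ - ‖b‖)]

/-- **Chord bound.** For unit `z, u` with `0 < ⟪z,u⟫` and unit `m, m' ⊥ u`: the angle `ψ`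
subtended at `z` (between `perpTo z m` and `perpTo z m'`) and the arc `ℓ = ∠(m,m')` satisfy
`⟪z,u⟫² (1 − cos ψ) ≤ 1 − cos ℓ`, i.e. `sin (ψ/2) ≤ sin (ℓ/2) / ⟪z,u⟫`. -/
theorem sq_inner_mul_one_sub_cos_le {z u m m' : V} (hz : ‖z‖ = 1) (hu : ‖u‖ = 1)
    (hσ : 0 < ⟪z, u⟫) (hm : ‖m‖ = 1) (hm' : ‖m'‖ = 1) (hmu : ⟪m, u⟫ = 0) (hm'u : ⟪m', u⟫ = 0) :
    ⟪z, u⟫ ^ 2 * (1 - Real.cos (angle (perpTo z m) (perpTo z m'))) ≤ 1 - ⟪m, m'⟫ := by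
  have ha := inner_le_norm_perpTo hz hu hσ hm hmu
  have hb := inner_le_norm_perpTo hz hu hσ hm' hm'u
  have ha0 : perpTo z m ≠ 0 := norm_pos_iff.1 (hσ.trans_le ha)
  have hb0 : perpTo z m' ≠ 0 := norm_pos_iff.1 (hσ.trans_le hb)
  have h1 := norm_mul_norm_mul_one_sub_cos_angle_le ha0 hb0
  -- the projected chord is at most the chord: `‖perpTo z m − perpTo z m'‖² ≤ ‖m − m'‖² = 2 − 2⟪m,m'⟫`
  have h2 : ‖perpTo z m - perpTo z m'‖ ^ 2 ≤ 2 - 2 * ⟪m, m'⟫ := by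
    rw [← perpTo_sub_right_of_unit hz]
    have h := norm_perpTo_le_of_unit hz (m - m')
    have hmm : ‖m - m'‖ ^ 2 = 2 - 2 * ⟪m, m'⟫ := by
      rw [norm_sub_sq_real, hm, hm']; ring
    rw [← hmm]
    exact pow_le_pow_left₀ (norm_nonneg _) h 2
  have hcos : 0 ≤ 1 - Real.cos (angle (perpTo z m) (perpTo z m')) := by
    linarith [Real.cos_le_one (angle (perpTo z m) (perpTo z m'))]
  -- `σ² (1 − cos ψ) ≤ ‖a‖‖b‖ (1 − cos ψ) ≤ ‖a − b‖²/2 ≤ 1 − ⟪m,m'⟫`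
  have h3 : ⟪z, u⟫ ^ 2 ≤ ‖perpTo z m‖ * ‖perpTo z m'‖ := by
    rw [pow_two]; exact mul_le_mul ha hb hσ.le (norm_nonneg _)
  calc ⟪z, u⟫ ^ 2 * (1 - Real.cos (angle (perpTo z m) (perpTo z m')))
      ≤ ‖perpTo z m‖ * ‖perpTo z m'‖ * (1 - Real.cos (angle (perpTo z m) (perpTo z m'))) :=
        mul_le_mul_of_nonneg_right h3 hcos
    _ ≤ ‖perpTo z m - perpTo z m'‖ ^ 2 / 2 := h1
    _ ≤ 1 - ⟪m, m'⟫ := by linarith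

/-! ## Part C. Small arcs: from the cosine inequality to the angle inequality -/

/-- **Small arcs.** If `σ² (1 − cos ψ) ≤ 1 − cos ℓ` with `0 ≤ ψ ≤ π`, `0 ≤ ℓ ≤ 1/16` and
`3/4 ≤ σ`, then `ψ ≤ (1001/1000) · ℓ / σ`. (From `1 − x²/2 ≤ cos x` and `Real.cos_bound`:
first `ψ ≤ 1/8`, then `ψ² (1 − 5ψ²/48) ≤ (ℓ/σ)²`.) -/
theorem angle_le_of_one_sub_cos {σ ψ ℓ : ℝ} (hσ : 3 / 4 ≤ σ) (hψ0 : 0 ≤ ψ)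
    (hψπ : ψ ≤ π) (hℓ0 : 0 ≤ ℓ) (hℓ : ℓ ≤ 1 / 16)
    (h : σ ^ 2 * (1 - Real.cos ψ) ≤ 1 - Real.cos ℓ) : ψ ≤ 1001 / 1000 * ℓ / σ := by
  have hσ0 : 0 < σ := by linarith
  -- `1 − cos ℓ ≤ ℓ²/2`
  have hℓc : 1 - Real.cos ℓ ≤ ℓ ^ 2 / 2 := by linarith [Real.one_sub_sq_div_two_le_cos (x := ℓ)]
  -- hence `1 − cos ψ ≤ ℓ² / (2 σ²) ≤ 1/288`
  have hY : 1 - Real.cos ψ ≤ ℓ ^ 2 / (2 * σ ^ 2) := by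
    rw [le_div_iff₀ (by positivity)]; nlinarith
  have hsmall : 1 - Real.cos ψ ≤ 1 / 288 := by
    have h1 : ℓ ^ 2 / (2 * σ ^ 2) ≤ (1 / 16) ^ 2 / (2 * (3 / 4) ^ 2) := by
      apply div_le_div₀ (by positivity) (pow_le_pow_left₀ hℓ0 hℓ 2) (by positivity)
      nlinarith
    linarith [hY, h1, show ((1:ℝ) / 16) ^ 2 / (2 * (3 / 4) ^ 2) = 1 / 288 by norm_num]
  -- so `ψ ≤ 1/8` (cosine is decreasing on `[0, π]`)
  have hψ8 : ψ ≤ 1 / 8 := by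
    by_contra hlt
    rw [not_le] at hlt
    have hb := Real.cos_bound (x := 1 / 8) (by rw [abs_of_pos (by norm_num)]; norm_num)
    have hc8 : Real.cos (1 / 8) ≤ 1 - 1 / 288 - 1 / 1000 := by
      have := (abs_le.1 hb).2
      rw [abs_of_pos (by norm_num : (0:ℝ) < 1 / 8)] at this
      nlinarith
    have hlt' : Real.cos ψ < Real.cos (1 / 8) :=
      Real.cos_lt_cos_of_nonneg_of_le_pi (by norm_num) hψπ hlt
    linarith
  -- `Real.cos_bound` at `ψ`: `1 − cos ψ ≥ ψ²/2 − 5ψ⁴/96`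
  have hbψ := Real.cos_bound (x := ψ) (by rw [abs_of_nonneg hψ0]; linarith)
  have hcψ : Real.cos ψ ≤ 1 - ψ ^ 2 / 2 + ψ ^ 4 * (5 / 96) := by
    have := (abs_le.1 hbψ).2
    rw [abs_of_nonneg hψ0] at this
    linarith
  -- combine: `ψ² (1 − 5ψ²/48) ≤ (ℓ/σ)²`, `ψ² ≤ 1/64`
  have hψ2 : ψ ^ 2 ≤ 1 / 64 := by nlinarith
  have hmain : ψ ^ 2 * (1 - 5 / 3072) * σ ^ 2 ≤ ℓ ^ 2 := by
    have h4 : ψ ^ 4 ≤ ψ ^ 2 * (1 / 64) := by nlinarith [sq_nonneg ψ]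
    nlinarith
  -- conclude `ψ σ ≤ (1001/1000) ℓ`
  have hR : 0 ≤ 1001 / 1000 * ℓ := by positivity
  have hL : 0 ≤ ψ * σ := by positivity
  have hsq : (ψ * σ) ^ 2 ≤ (1001 / 1000 * ℓ) ^ 2 := by nlinarith
  have hle : ψ * σ ≤ 1001 / 1000 * ℓ := by
    have := Real.sqrt_le_sqrt hsq
    rwa [Real.sqrt_sq hL, Real.sqrt_sq hR] at this
  rw [le_div_iff₀ hσ0]
  exact hle

/-! ## Part D. Bisection of an arc -/

/-- The norm of `m + m'` for unit `m, m'`: `‖m + m'‖² = 2 + 2 ⟪m, m'⟫`. -/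
theorem norm_add_sq_of_units {m m' : V} (hm : ‖m‖ = 1) (hm' : ‖m'‖ = 1) :
    ‖m + m'‖ ^ 2 = 2 + 2 * ⟪m, m'⟫ := by
  rw [norm_add_sq_real, hm, hm']; ring

/-- **The midpoint halves the arc (left half).** For unit `m, m'` with `∠(m,m') < π`:
`∠(m, m + m') = ∠(m, m')/2`. -/
theorem angle_midpoint_left {m m' : V} (hm : ‖m‖ = 1) (hm' : ‖m'‖ = 1) (hlt : angle m m' < π) :
    angle m (m + m') = angle m m' / 2 := by
  have hm0 : m ≠ 0 := fun h => by rw [h, norm_zero] at hm; exact zero_ne_one hm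
  have hm0' : m' ≠ 0 := fun h => by rw [h, norm_zero] at hm'; exact zero_ne_one hm'
  have hc : -1 < ⟪m, m'⟫ := by
    have hge : -1 ≤ ⟪m, m'⟫ := by
      have := neg_le_of_abs_le (abs_real_inner_le_norm m m'); rw [hm, hm', mul_one] at this; exact this
    rcases hge.lt_or_eq with hlt' | heq
    · exact hlt'
    · exfalso
      have : angle m m' = π :=
        (inner_eq_neg_mul_norm_iff_angle_eq_pi hm0 hm0').1 (by rw [hm, hm', mul_one]; exact heq.symm)
      exact hlt.ne this
  have hv2 : ‖m + m'‖ ^ 2 = 2 + 2 * ⟪m, m'⟫ := norm_add_sq_of_units hm hm'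
  have hvpos : 0 < ‖m + m'‖ := by
    rcases (norm_nonneg (m + m')).lt_or_eq with h | h
    · exact h
    · exfalso; rw [← h] at hv2; norm_num at hv2; linarith
  -- cosines agree and both angles lie in `[0, π]`
  apply Real.injOn_cos ⟨angle_nonneg _ _, angle_le_pi _ _⟩
    ⟨by linarith [angle_nonneg m m'], by linarith [angle_le_pi m m', Real.pi_pos]⟩
  rw [cos_angle, Real.cos_half (by linarith [angle_nonneg m m']) (angle_le_pi _ _), cos_angle, hm,
    hm', one_mul, mul_one, div_one, inner_add_right, real_inner_self_eq_norm_sq, hm, one_pow]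
  -- `(1 + c)/‖m+m'‖ = √((1+c)/2)` with `‖m+m'‖ = √(2+2c)`
  have hv : ‖m + m'‖ = Real.sqrt (2 + 2 * ⟪m, m'⟫) := by
    rw [← hv2, Real.sqrt_sq (norm_nonneg _)]
  rw [hv]
  have h1c : 0 < 1 + ⟪m, m'⟫ := by linarith
  rw [show (2 : ℝ) + 2 * ⟪m, m'⟫ = 2 * (1 + ⟪m, m'⟫) by ring, div_eq_iff (Real.sqrt_pos.2 (by linarith)).ne',
    ← Real.sqrt_mul (by linarith : (0:ℝ) ≤ (1 + ⟪m, m'⟫) / 2)]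
  rw [show (1 + ⟪m, m'⟫) / 2 * (2 * (1 + ⟪m, m'⟫)) = (1 + ⟪m, m'⟫) ^ 2 by ring, Real.sqrt_sq h1c.le]

/-- **The midpoint halves the arc (right half).** `∠(m + m', m') = ∠(m, m')/2`. -/
theorem angle_midpoint_right {m m' : V} (hm : ‖m‖ = 1) (hm' : ‖m'‖ = 1) (hlt : angle m m' < π) :
    angle (m + m') m' = angle m m' / 2 := by
  rw [angle_comm, add_comm, angle_midpoint_left hm' hm (by rwa [angle_comm]), angle_comm]

/-- **Bisection induction.** For unit `z, u` with `3/4 ≤ σ = ⟪z,u⟫` and unit `m, m' ⊥ u`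
with `∠(m,m') ≤ 2^k/16` and `∠(m,m') < π`: `∠(perpTo z m, perpTo z m') ≤ (1001/1000) ∠(m,m')/σ`. -/
theorem angle_perpTo_le_bisect {z u : V} (hz : ‖z‖ = 1) (hu : ‖u‖ = 1) (hσ : 3 / 4 ≤ ⟪z, u⟫)
    (k : ℕ) :
    ∀ m m' : V, ‖m‖ = 1 → ‖m'‖ = 1 → ⟪m, u⟫ = 0 → ⟪m', u⟫ = 0 → angle m m' ≤ 2 ^ k / 16 →
      angle m m' < π → angle (perpTo z m) (perpTo z m') ≤ 1001 / 1000 * angle m m' / ⟪z, u⟫ := by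
  have hσ0 : 0 < ⟪z, u⟫ := by linarith
  induction k with
  | zero =>
    intro m m' hm hm' hmu hm'u hle _
    have hle' : angle m m' ≤ 1 / 16 := by rw [pow_zero] at hle; linarith
    have hA := sq_inner_mul_one_sub_cos_le hz hu hσ0 hm hm' hmu hm'u
    have hcos : ⟪m, m'⟫ = Real.cos (angle m m') := by
      rw [cos_angle, hm, hm', mul_one, div_one]
    rw [hcos] at hA
    exact angle_le_of_one_sub_cos hσ (angle_nonneg _ _) (angle_le_pi _ _) (angle_nonneg _ _) hle' hA
  | succ k ih =>
    intro m m' hm hm' hmu hm'u hle hlt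
    -- the midpoint `c = m + m'` (not normalised: angles are scale invariant)
    have hl := angle_midpoint_left hm hm' hlt
    have hr := angle_midpoint_right hm hm' hlt
    have hv2 : ‖m + m'‖ ^ 2 = 2 + 2 * ⟪m, m'⟫ := norm_add_sq_of_units hm hm'
    have hm0 : m ≠ 0 := fun h => by rw [h, norm_zero] at hm; exact zero_ne_one hm
    have hm0' : m' ≠ 0 := fun h => by rw [h, norm_zero] at hm'; exact zero_ne_one hm'
    have hc : -1 < ⟪m, m'⟫ := by
      by_contra hge
      rw [not_lt] at hge
      have hge' : -1 ≤ ⟪m, m'⟫ := by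
        have := neg_le_of_abs_le (abs_real_inner_le_norm m m'); rw [hm, hm', mul_one] at this
        exact this
      have heq : ⟪m, m'⟫ = -1 := le_antisymm hge hge'
      have : angle m m' = π :=
        (inner_eq_neg_mul_norm_iff_angle_eq_pi hm0 hm0').1 (by rw [hm, hm', mul_one, heq])
      exact hlt.ne this
    have hvpos : 0 < ‖m + m'‖ := by
      rcases (norm_nonneg (m + m')).lt_or_eq with h | h
      · exact h
      · exfalso; have := hv2; rw [← h] at this; nlinarith
    -- normalised midpoint
    set c := ‖m + m'‖⁻¹ • (m + m') with hcdef
    have hcn : ‖c‖ = 1 := by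
      rw [hcdef, norm_smul, norm_inv, norm_norm, inv_mul_cancel₀ hvpos.ne']
    have hcu : ⟪c, u⟫ = 0 := by
      rw [hcdef, real_inner_smul_left, inner_add_left, hmu, hm'u, add_zero, mul_zero]
    have hinv : 0 < ‖m + m'‖⁻¹ := inv_pos.2 hvpos
    have hmc : angle m c = angle m m' / 2 := by rw [hcdef, angle_smul_right_of_pos _ _ hinv, hl]
    have hcm' : angle c m' = angle m m' / 2 := by rw [hcdef, angle_smul_left_of_pos _ _ hinv, hr]
    have hpow : (2 : ℝ) ^ (k + 1) = 2 ^ k * 2 := pow_succ 2 k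
    rw [hpow] at hle
    have h1 := ih m c hm hcn hmu hcu (by rw [hmc]; linarith)
      (by rw [hmc]; linarith [angle_le_pi m m', Real.pi_pos])
    have h2 := ih c m' hcn hm' hcu hm'u (by rw [hcm']; linarith)
      (by rw [hcm']; linarith [angle_le_pi m m', Real.pi_pos])
    calc angle (perpTo z m) (perpTo z m')
        ≤ angle (perpTo z m) (perpTo z c) + angle (perpTo z c) (perpTo z m') :=
          angle_le_angle_add_angle _ _ _
      _ ≤ 1001 / 1000 * angle m c / ⟪z, u⟫ + 1001 / 1000 * angle c m' / ⟪z, u⟫ := add_le_add h1 h2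
      _ = 1001 / 1000 * angle m m' / ⟪z, u⟫ := by rw [hmc, hcm']; ring

/-! ## Part E. The polar bound -/

/-- **Polar length bound.** Let `z, u` be unit vectors with `3/4 ≤ s ≤ ⟪z, u⟫` and `s ≤ 1` (the
great circle `u⊥` is at spherical distance `≥ arcsin s ≥ 48.6°` from `z`), and let `m, m'` be
unit vectors on that great circle. Then the arc `m m'` is at least `s` times the angle it subtends
at `z`, up to the factor `1001/1000`:
`s · ∠(perpTo z m, perpTo z m') ≤ (1001/1000) · ∠(m, m')`. -/
theorem mul_angle_perpTo_le {z u m m' : V} (hz : ‖z‖ = 1) (hu : ‖u‖ = 1) {s : ℝ} (hs : 3 / 4 ≤ s)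
    (hs1 : s ≤ 1) (hσ : s ≤ ⟪z, u⟫) (hm : ‖m‖ = 1) (hm' : ‖m'‖ = 1) (hmu : ⟪m, u⟫ = 0)
    (hm'u : ⟪m', u⟫ = 0) :
    s * angle (perpTo z m) (perpTo z m') ≤ 1001 / 1000 * angle m m' := by
  have hσ0 : 0 < ⟪z, u⟫ := by linarith
  rcases (angle_le_pi m m').lt_or_eq with hlt | heq
  · have h := angle_perpTo_le_bisect hz hu (hs.trans hσ) 6 m m' hm hm' hmu hm'u
      (by have := angle_le_pi m m'; have := Real.pi_le_four; norm_num; linarith) hlt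
    rw [le_div_iff₀ hσ0] at h
    calc s * angle (perpTo z m) (perpTo z m') ≤ ⟪z, u⟫ * angle (perpTo z m) (perpTo z m') :=
          mul_le_mul_of_nonneg_right hσ (angle_nonneg _ _)
      _ ≤ 1001 / 1000 * angle m m' := by rw [mul_comm]; exact h
  · rw [heq]
    calc s * angle (perpTo z m) (perpTo z m') ≤ 1 * π :=
          mul_le_mul hs1 (angle_le_pi _ _) (angle_nonneg _ _) zero_le_one
      _ ≤ 1001 / 1000 * π := by nlinarith [Real.pi_pos]

end Summit.Ventures.Crystal3D

end
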